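import Summits.Ventures.PercRepro.S2CubeMultiplicityB

/-!
# PercRepro — S2: THE CUBIC MULTIPLICITY — `ν + 3·C(ν, 2) + 3·C(ν, 3)` spanning subsets
(p4, gen 16; paper proofs/P4-MULT-CUBE.md; parts A / B hold the lemmas)

`three_le_card_filter_good_pairs`: for three distinct extras `e, f, g ∈ cl(I) ∖ I` at least three pairs `P ⊆ I`
satisfy `I ⊆ cl((I ∖ P) ∪ {e, f, g})` (the bad pairs form an equivalence relation on the support union `W`;
not all pairs are bad; with `≥ 2` classes the cross pairs number `≥ |W| − 1 ≥ 3` when `|W| ≥ 4`, and `|W| = 3`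
has all pairs good). `card_spanF_ge_cube`: a rank-`q` set `B` of `q + ν` elements (every circuit of `≥ 3`
elements, every rank-`2` set of `≤ 3` points) has `≥ ν + 3·C(ν, 2) + 3·C(ν, 3)` spanning `(q+1)`-subsets — the
sets `(I ∖ P) ∪ T` for `T ⊆ B ∖ I` of `1`, `2`, `3` elements and good `P ⊆ I` (`1`, `≥ 3`, `≥ 3` per `T`).
At `ν = 3` this is `15`, p8's `card_spanF_ge_fifteen`; it sharpens p7's `card_spanF_ge_three` (`ν + 3·C(ν, 2)`) by the
cubic term. Axioms: standard.
-/

open scoped Matroid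

namespace PercRepro

namespace S2

open Set

variable {α : Type} {M : Matroid α}

open scoped Classical in
/-- **THREE GOOD PAIRS PER TRIPLE OF EXTRAS** (LEMMA of proofs/P4-MULT-CUBE.md §2): for `I` independent and three
distinct extras `e, f, g ∈ cl(I) ∖ I`, at least three pairs `P ⊆ I` satisfy `I ⊆ cl((I ∖ P) ∪ {e, f, g})`
(every circuit has `≥ 3` elements, every rank-`2` set has `≤ 3` points). -/
theorem three_le_card_filter_good_pairs [M.Finite] {I : Finset α} {e f g : α}
    (hcirc : ∀ C, M.IsCircuit C → 3 ≤ C.encard) (hC1 : ∀ L ⊆ M.E, M.eRk L = 2 → L.ncard ≤ 3)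
    (hI : M.Indep (I : Set α)) (hIE : (I : Set α) ⊆ M.E)
    (he : e ∈ M.closure (I : Set α)) (hf : f ∈ M.closure (I : Set α)) (hg : g ∈ M.closure (I : Set α))
    (heI : e ∉ I) (hfI : f ∉ I) (hgI : g ∉ I) (hef : e ≠ f) (heg : e ≠ g) (hfg : f ≠ g) :
    3 ≤ ((I.powersetCard 2).filter
      (fun P : Finset α => (I : Set α) ⊆ M.closure (((I : Set α) \ (P : Set α)) ∪ {e, f, g}))).card := by
  set T : Set α := {e, f, g} with hT
  have hTcl : T ⊆ M.closure (I : Set α) := by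
    intro t ht
    rcases ht with rfl | rfl | rfl
    · exact he
    · exact hf
    · exact hg
  have hTE : T ⊆ M.E := hTcl.trans (M.closure_subset_ground _)
  have hTI : ∀ t ∈ T, t ∉ I := by
    intro t ht
    rcases ht with rfl | rfl | rfl
    · exact heI
    · exact hfI
    · exact hgI
  have heT : e ∈ T := by simp [hT]
  have hfT : f ∈ T := by simp [hT]
  -- the support union
  set W : Finset α := I.filter (fun v => ∃ s ∈ T, v ∈ M.fundCircuit s (I : Set α)) with hWdef
  have hWI : W ⊆ I := Finset.filter_subset _ _
  have hW : ∀ v ∈ I, v ∈ W ↔ ∃ s ∈ T, v ∈ M.fundCircuit s (I : Set α) := by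
    intro v hv
    rw [hWdef, Finset.mem_filter]
    exact ⟨fun h => h.2, fun h => ⟨hv, h⟩⟩
  have h3 : 3 ≤ W.card := by
    refine (three_le_card_filter_pair hcirc hC1 hI hIE he heI hf hfI hef (hTE heT) (hTE hfT)).trans
      (Finset.card_le_card ?_)
    intro z hz
    rw [Finset.mem_filter] at hz
    rw [hWdef, Finset.mem_filter]
    refine ⟨hz.1, ?_⟩
    rcases hz.2 with h | h
    · exact ⟨e, heT, h⟩
    · exact ⟨f, hfT, h⟩
  -- a pair of support elements is good as soon as one of its elements is recovered
  have hgood : ∀ x ∈ W, ∀ y ∈ W, x ≠ y → x ∈ M.closure (((I : Set α) \ {x, y}) ∪ T) →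
      (I : Set α) ⊆ M.closure (((I : Set α) \ {x, y}) ∪ T) := by
    intro x hx y hy hxy hxcl
    obtain ⟨t, ht, hyt⟩ := (hW y (hWI hy)).1 hy
    have hycl := mem_closure_pair_of_mem hI hIE hTE (hTcl ht) (hTI t ht) (hWI hx) (hWI hy) hxy hyt ht hxcl
    intro a ha
    by_cases hax : a = x
    · rw [hax]; exact hxcl
    by_cases hay : a = y
    · rw [hay]; exact hycl
    exact M.mem_closure_of_mem (Or.inl ⟨ha, by
      simp only [Set.mem_insert_iff, Set.mem_singleton_iff, not_or]; exact ⟨hax, hay⟩⟩)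
      (Set.union_subset (Set.sdiff_subset.trans hIE) hTE)
  -- the pairs of `W` as elements of the filtered family
  have hmem : ∀ x ∈ W, ∀ y ∈ W, x ≠ y → x ∈ M.closure (((I : Set α) \ {x, y}) ∪ T) →
      ({x, y} : Finset α) ∈ (I.powersetCard 2).filter
        (fun P : Finset α => (I : Set α) ⊆ M.closure (((I : Set α) \ (P : Set α)) ∪ {e, f, g})) := by
    intro x hx y hy hxy hxcl
    rw [Finset.mem_filter, Finset.mem_powersetCard]
    refine ⟨⟨?_, Finset.card_pair hxy⟩, ?_⟩
    · intro a ha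
      rcases Finset.mem_insert.1 ha with rfl | ha
      · exact hWI hx
      · exact (Finset.mem_singleton.1 ha) ▸ hWI hy
    · rw [Finset.coe_pair]
      exact hgood x hx y hy hxy hxcl
  by_cases hw : W.card = 3
  · -- every pair of `W` is good
    have hsub : W.powersetCard 2 ⊆ (I.powersetCard 2).filter
        (fun P : Finset α => (I : Set α) ⊆ M.closure (((I : Set α) \ (P : Set α)) ∪ {e, f, g})) := by
      intro P hP
      rw [Finset.mem_powersetCard] at hP
      obtain ⟨x, y, hxy, rfl⟩ := Finset.card_eq_two.1 hP.2
      have hx : x ∈ W := hP.1 (Finset.mem_insert_self x {y})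
      have hy : y ∈ W := hP.1 (Finset.mem_insert_of_mem (Finset.mem_singleton_self y))
      exact hmem x hx y hy hxy
        (mem_closure_sdiff_pair_union_of_card_three hcirc hC1 hI hTcl hTI hef heg hfg hWI hW hw hx hxy)
    have := Finset.card_le_card hsub
    rw [Finset.card_powersetCard, hw] at this
    exact this
  · -- `|W| ≥ 4`: the class of a support element `x` with a good partner against its complement
    have h4 : 4 ≤ W.card := by omega
    obtain ⟨x, hx, y, hy, hxy, hxcl⟩ :=
      exists_mem_closure_sdiff_pair_union hcirc hI hTE hTcl hTI hWI hW heT hfT hef h3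
    set K : Finset α := W.filter (fun v => v = x ∨ x ∉ M.closure (((I : Set α) \ {x, v}) ∪ T)) with hK
    have hxK : x ∈ K := by rw [hK, Finset.mem_filter]; exact ⟨hx, Or.inl rfl⟩
    have hyK : y ∉ K := by
      rw [hK, Finset.mem_filter]
      rintro ⟨-, h | h⟩
      · exact hxy h.symm
      · exact h hxcl
    have hKW : K ⊆ W := Finset.filter_subset _ _
    -- a member of `K` and a non-member of `K` form a good pair
    have hcross : ∀ a ∈ K, ∀ b ∈ W \ K, a ∈ M.closure (((I : Set α) \ {a, b}) ∪ T) := by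
      intro a haK b hb
      rw [Finset.mem_sdiff] at hb
      have hbK : b ∉ K := hb.2
      have hbx : b ≠ x := fun h => hbK (by rw [hK, Finset.mem_filter]; exact ⟨hb.1, Or.inl h⟩)
      have hxb : x ∈ M.closure (((I : Set α) \ {x, b}) ∪ T) := by
        by_contra h
        exact hbK (by rw [hK, Finset.mem_filter]; exact ⟨hb.1, Or.inr h⟩)
      by_cases hax : a = x
      · rw [hax]; exact hxb
      · have hbad : x ∉ M.closure (((I : Set α) \ {x, a}) ∪ T) := by
          have haK' := haK
          rw [hK, Finset.mem_filter] at haK'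
          rcases haK'.2 with h | h
          · exact absurd h hax
          · exact h
        have hab : a ≠ b := fun h => hbK (h ▸ haK)
        by_contra habad
        exact (notMem_closure_pair_trans (Finset.mem_coe.2 (hWI hx)) (Finset.mem_coe.2 (hWI (hKW haK)))
          (Finset.mem_coe.2 (hWI hb.1)) (Ne.symm hax) hab (Ne.symm hbx) hbad habad) hxb
    -- the injection `(a, b) ↦ {a, b}` from `K × (W ∖ K)` into the good pairs
    have hinj : (K ×ˢ (W \ K)).card ≤ ((I.powersetCard 2).filter
        (fun P : Finset α => (I : Set α) ⊆ M.closure (((I : Set α) \ (P : Set α)) ∪ {e, f, g}))).card := by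
      refine Finset.card_le_card_of_injOn (fun p => ({p.1, p.2} : Finset α)) ?_ ?_
      · intro p hp
        rw [Finset.mem_coe, Finset.mem_product] at hp
        have hab : p.1 ≠ p.2 := fun h => (Finset.mem_sdiff.1 hp.2).2 (h ▸ hp.1)
        exact hmem p.1 (hKW hp.1) p.2 (Finset.mem_sdiff.1 hp.2).1 hab (hcross p.1 hp.1 p.2 hp.2)
      · intro p hp p' hp' hpp'
        rw [Finset.mem_coe, Finset.mem_product] at hp hp'
        have hpp'' : ({p.1, p.2} : Finset α) = {p'.1, p'.2} := hpp'
        have h1 : p.1 ∈ ({p'.1, p'.2} : Finset α) := by rw [← hpp'']; exact Finset.mem_insert_self _ _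
        have h2 : p.2 ∈ ({p'.1, p'.2} : Finset α) := by
          rw [← hpp'']; exact Finset.mem_insert_of_mem (Finset.mem_singleton_self _)
        rcases Finset.mem_insert.1 h1 with h1 | h1
        · rcases Finset.mem_insert.1 h2 with h2 | h2
          · exact absurd (h2 ▸ hp'.1) (Finset.mem_sdiff.1 hp.2).2
          · exact Prod.ext h1 (Finset.mem_singleton.1 h2)
        · exact absurd ((Finset.mem_singleton.1 h1) ▸ hp.1) (Finset.mem_sdiff.1 hp'.2).2
    rw [Finset.card_product, Finset.card_sdiff_of_subset hKW] at hinj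
    have hK1 : 1 ≤ K.card := Finset.card_pos.2 ⟨x, hxK⟩
    have hKlt : K.card < W.card := Finset.card_lt_card (Finset.ssubset_iff_of_subset hKW |>.2 ⟨y, hy, hyK⟩)
    refine le_trans ?_ hinj
    set k := K.card with hk
    set w := W.card with hwdef
    have hm : 1 ≤ w - k := by omega
    rcases Nat.lt_or_ge k 2 with hk2 | hk2
    · have : k = 1 := by omega
      rw [this]; omega
    · rcases Nat.lt_or_ge (w - k) 2 with hm2 | hm2
      · have : w - k = 1 := by omega
        rw [this]; omega
      · calc 3 ≤ 2 * 2 := by norm_num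
          _ ≤ k * (w - k) := Nat.mul_le_mul hk2 hm2

open scoped Classical in
/-- `((I ∖ P) ∪ T) ∖ I = T` and `I ∖ ((I ∖ P) ∪ T) = P` when `T` misses `I` and `P ⊆ I`. -/
theorem sdiff_union_recover {I T P : Finset α} (hTI : ∀ t ∈ T, t ∉ I) (hPI : P ⊆ I) :
    ((I \ P) ∪ T) \ I = T ∧ I \ ((I \ P) ∪ T) = P := by
  constructor
  · ext a
    simp only [Finset.mem_sdiff, Finset.mem_union]
    constructor
    · rintro ⟨h1 | h1, h2⟩
      · exact absurd h1.1 h2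
      · exact h1
    · intro ha
      exact ⟨Or.inr ha, hTI a ha⟩
  · ext a
    simp only [Finset.mem_sdiff, Finset.mem_union, not_or, not_and, not_not]
    constructor
    · rintro ⟨h1, h2, h3⟩
      exact h2 h1
    · intro ha
      exact ⟨hPI ha, fun _ => ha, fun h => hTI a h (hPI ha)⟩

open scoped Classical in
/-- **THE CUBIC MULTIPLICITY**: a rank-`q` set `B` of `m = q + ν` elements (every circuit of `≥ 3` elements, every
rank-`2` set of `≤ 3` points) has at least `ν + 3·C(ν, 2) + 3·C(ν, 3)` spanning `(q+1)`-subsets — the sets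
`(I ∖ P) ∪ T` with `T ⊆ B ∖ I` of `1`, `2` or `3` elements and `P ⊆ I` of one element less, `P` «good»
(`I ⊆ cl((I ∖ P) ∪ T)`): `1` per single, `≥ 3` per pair (p7's three exchange points), `≥ 3` per triple
(`three_le_card_filter_good_pairs`). -/
theorem card_spanF_ge_cube [M.Finite] (q : ℕ) (_hq : 1 ≤ q) (hcirc : ∀ C, M.IsCircuit C → 3 ≤ C.encard)
    (hC1 : ∀ L ⊆ M.E, M.eRk L = 2 → L.ncard ≤ 3)
    {B : Finset α} (hBE : (B : Set α) ⊆ M.E) (hBq : M.eRk (B : Set α) = (q : ℕ∞)) :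
    (B.card - q) + 3 * (B.card - q).choose 2 + 3 * (B.card - q).choose 3 ≤ (spanF M q B).card := by
  obtain ⟨I₀, hI₀⟩ := M.exists_isBasis (B : Set α) hBE
  have hI₀fin : I₀.Finite := B.finite_toSet.subset hI₀.subset
  set I : Finset α := hI₀fin.toFinset with hIdef
  have hIcoe : (I : Set α) = I₀ := Set.Finite.coe_toFinset _
  have hIB : I ⊆ B := by
    intro x hx
    rw [hIdef, Set.Finite.mem_toFinset] at hx
    exact_mod_cast hI₀.subset hx
  have hIcard : I.card = q := by
    have h := hI₀.encard_eq_eRk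
    rw [hBq, ← hI₀fin.cast_ncard_eq] at h
    have h' : I₀.ncard = q := by exact_mod_cast h
    rw [hIdef, ← Set.ncard_eq_toFinset_card _ hI₀fin]; exact h'
  have hIind : M.Indep (I : Set α) := by rw [hIcoe]; exact hI₀.indep
  have hIE : (I : Set α) ⊆ M.E := hIind.subset_ground
  have hBcl : (B : Set α) ⊆ M.closure (I : Set α) := by rw [hIcoe]; exact hI₀.subset_closure
  set X : Finset α := B \ I with hXdef
  have hXcard : X.card = B.card - q := by
    rw [hXdef, Finset.card_sdiff_of_subset hIB, hIcard]
  have hXI : ∀ x ∈ X, x ∉ I := fun x hx => (Finset.mem_sdiff.1 hx).2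
  have hXB : ∀ x ∈ X, x ∈ B := fun x hx => (Finset.mem_sdiff.1 hx).1
  have hXcl : ∀ x ∈ X, x ∈ M.closure (I : Set α) := fun x hx => hBcl (by exact_mod_cast hXB x hx)
  have hXE : ∀ x ∈ X, x ∈ M.E := fun x hx => hBE (by exact_mod_cast hXB x hx)
  -- the index family: `(T, P)` with `T ⊆ X` of `1`, `2`, `3` elements, `P ⊆ I` of `|T| − 1` elements, `P` good
  set good : Finset α → Finset α → Prop :=
    fun T P => (I : Set α) ⊆ M.closure (((I : Set α) \ (P : Set α)) ∪ (T : Set α)) with hgood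
  set Ts : Finset (Finset α) := X.powersetCard 1 ∪ X.powersetCard 2 ∪ X.powersetCard 3 with hTs
  set S : Finset (Σ _ : Finset α, Finset α) :=
    Ts.sigma (fun T => (I.powersetCard (T.card - 1)).filter (fun P => good T P)) with hS
  set gmap : (Σ _ : Finset α, Finset α) → Set α := fun s => (((I \ s.2) ∪ s.1 : Finset α) : Set α) with hgmap
  have hTsX : ∀ T ∈ Ts, T ⊆ X ∧ 1 ≤ T.card := by
    intro T hT
    rw [hTs, Finset.mem_union, Finset.mem_union, Finset.mem_powersetCard, Finset.mem_powersetCard,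
      Finset.mem_powersetCard] at hT
    rcases hT with (h | h) | h
    · exact ⟨h.1, by omega⟩
    · exact ⟨h.1, by omega⟩
    · exact ⟨h.1, by omega⟩
  have hSdata : ∀ s ∈ S, s.1 ⊆ X ∧ 1 ≤ s.1.card ∧ s.2 ⊆ I ∧ s.2.card = s.1.card - 1 ∧ good s.1 s.2 := by
    intro s hs
    rw [hS, Finset.mem_sigma, Finset.mem_filter, Finset.mem_powersetCard] at hs
    obtain ⟨hT, ⟨hP, hPc⟩, hg⟩ := hs
    exact ⟨(hTsX _ hT).1, (hTsX _ hT).2, hP, hPc, hg⟩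
  -- (1) every indexed set is a spanning `(q+1)`-subset
  have hsub : S.image gmap ⊆ spanF M q B := by
    intro D hD
    rw [Finset.mem_image] at hD
    obtain ⟨s, hs, rfl⟩ := hD
    obtain ⟨hTX, hT1, hPI, hPc, hg⟩ := hSdata s hs
    have hTI : ∀ t ∈ s.1, t ∉ I := fun t ht => hXI t (hTX ht)
    have hdisj : Disjoint (I \ s.2) s.1 := by
      rw [Finset.disjoint_left]
      intro a ha ha'
      exact hTI a ha' (Finset.mem_sdiff.1 ha).1
    have hDB : (I \ s.2) ∪ s.1 ⊆ B := Finset.union_subset (Finset.sdiff_subset.trans hIB) (hTX.trans Finset.sdiff_subset)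
    have hcoe : (((I \ s.2) ∪ s.1 : Finset α) : Set α) = ((I : Set α) \ (s.2 : Set α)) ∪ (s.1 : Set α) := by
      push_cast; rfl
    have hcl : (B : Set α) ⊆ M.closure (((I \ s.2) ∪ s.1 : Finset α) : Set α) := by
      rw [hcoe]
      exact hBcl.trans (M.closure_subset_closure_of_subset_closure hg)
    rw [mem_spanF]
    refine ⟨(I \ s.2) ∪ s.1, hDB, ?_, ?_, hcl, rfl⟩
    · have hPle : s.2.card ≤ I.card := Finset.card_le_card hPI
      rw [Finset.card_union_of_disjoint hdisj, Finset.card_sdiff_of_subset hPI, hIcard, hPc]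
      rw [hIcard] at hPle
      omega
    · exact eRk_eq_of_subset_of_subset_closure (by exact_mod_cast hDB) hBq hcl
  -- (2) the indexing is injective: `T = D ∖ I`, `P = I ∖ D`
  have hinj : Set.InjOn gmap (S : Set (Σ _ : Finset α, Finset α)) := by
    intro s hs s' hs' h
    obtain ⟨hTX, -, hPI, -, -⟩ := hSdata s (Finset.mem_coe.1 hs)
    obtain ⟨hTX', -, hPI', -, -⟩ := hSdata s' (Finset.mem_coe.1 hs')
    have h' : ((I \ s.2) ∪ s.1 : Finset α) = (I \ s'.2) ∪ s'.1 := Finset.coe_inj.1 h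
    have r1 := sdiff_union_recover (I := I) (fun t ht => hXI t (hTX ht)) hPI
    have r2 := sdiff_union_recover (I := I) (fun t ht => hXI t (hTX' ht)) hPI'
    have hT : s.1 = s'.1 := by rw [← r1.1, h', r2.1]
    have hP : s.2 = s'.2 := by rw [← r1.2, h', r2.2]
    exact Sigma.ext hT (heq_of_eq hP)
  have hcardS : S.card ≤ (spanF M q B).card := by
    calc S.card = (S.image gmap).card := (Finset.card_image_of_injOn hinj).symm
      _ ≤ (spanF M q B).card := Finset.card_le_card hsub
  -- (3) the count of the index family
  have hcount : X.card + 3 * X.card.choose 2 + 3 * X.card.choose 3 ≤ S.card := by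
    rw [hS, Finset.card_sigma]
    have hd1 : Disjoint (X.powersetCard 1) (X.powersetCard 2) := by
      rw [Finset.disjoint_left]
      intro T h1 h2
      rw [Finset.mem_powersetCard] at h1 h2
      omega
    have hd2 : Disjoint (X.powersetCard 1 ∪ X.powersetCard 2) (X.powersetCard 3) := by
      rw [Finset.disjoint_left]
      intro T h1 h2
      rw [Finset.mem_union, Finset.mem_powersetCard, Finset.mem_powersetCard] at h1
      rw [Finset.mem_powersetCard] at h2
      omega
    rw [hTs, Finset.sum_union hd2, Finset.sum_union hd1]
    -- singles: exactly one good `P = ∅`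
    have h1 : ∀ T ∈ X.powersetCard 1,
        1 ≤ ((I.powersetCard (T.card - 1)).filter (fun P => good T P)).card := by
      intro T hT
      rw [Finset.mem_powersetCard] at hT
      refine Finset.card_pos.2 ⟨∅, ?_⟩
      rw [Finset.mem_filter, Finset.mem_powersetCard, hT.2]
      refine ⟨⟨Finset.empty_subset _, Finset.card_empty⟩, ?_⟩
      rw [hgood]
      simp only [Finset.coe_empty, Set.sdiff_empty]
      exact (M.subset_closure _ hIE).trans (M.closure_subset_closure Set.subset_union_left)
    -- pairs: three exchange points (p7)
    have h2 : ∀ T ∈ X.powersetCard 2,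
        3 ≤ ((I.powersetCard (T.card - 1)).filter (fun P => good T P)).card := by
      intro T hT
      rw [Finset.mem_powersetCard] at hT
      obtain ⟨x, y, hxy, rfl⟩ := Finset.card_eq_two.1 hT.2
      have hxX : x ∈ X := hT.1 (Finset.mem_insert_self x {y})
      have hyX : y ∈ X := hT.1 (Finset.mem_insert_of_mem (Finset.mem_singleton_self y))
      have h3 := three_le_card_filter_pair hcirc hC1 hIind hIE (hXcl x hxX) (hXI x hxX) (hXcl y hyX) (hXI y hyX)
        hxy (hXE x hxX) (hXE y hyX)
      refine h3.trans ?_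
      refine Finset.card_le_card_of_injOn (fun z => ({z} : Finset α)) ?_ ?_
      · intro z hz
        rw [Finset.mem_coe, Finset.mem_filter] at hz
        rw [Finset.mem_coe, Finset.mem_filter, Finset.mem_powersetCard, Finset.card_pair hxy]
        refine ⟨⟨Finset.singleton_subset_iff.2 hz.1, Finset.card_singleton z⟩, ?_⟩
        rw [hgood]
        -- `z` is recovered by the extra whose circuit contains it; the rest of `I` is there
        have hrec : ∀ t ∈ ({x, y} : Finset α), z ∈ M.fundCircuit t (I : Set α) →
            z ∈ M.closure (((I : Set α) \ ({z} : Finset α)) ∪ (({x, y} : Finset α) : Set α)) := by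
          intro t ht hzt
          have htX : t ∈ X := hT.1 ht
          have h := mem_closure_insert_of_mem_fundCircuit hIind (hXcl t htX) (hXI t htX) (by exact_mod_cast hz.1) hzt
          refine M.closure_subset_closure ?_ h
          intro a ha
          rcases ha with rfl | ha
          · exact Or.inr (by exact_mod_cast ht)
          · exact Or.inl (by simpa using ha)
        intro a ha
        by_cases haz : a = z
        · rw [haz]
          rcases hz.2 with h | h
          · exact hrec x (Finset.mem_insert_self x {y}) h
          · exact hrec y (Finset.mem_insert_of_mem (Finset.mem_singleton_self y)) h
        · exact M.mem_closure_of_mem (Or.inl ⟨ha, by simpa using haz⟩)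
            (Set.union_subset (Set.sdiff_subset.trans hIE) (by
              intro b hb
              exact hXE b (hT.1 (by exact_mod_cast hb))))
      · intro z _ z' _ h
        exact Finset.singleton_inj.1 h
    -- triples: three good pairs
    have h3 : ∀ T ∈ X.powersetCard 3,
        3 ≤ ((I.powersetCard (T.card - 1)).filter (fun P => good T P)).card := by
      intro T hT
      rw [Finset.mem_powersetCard] at hT
      obtain ⟨e, f, g, hef, heg, hfg, rfl⟩ := Finset.card_eq_three.1 hT.2
      have heX : e ∈ X := hT.1 (by simp)
      have hfX : f ∈ X := hT.1 (by simp)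
      have hgX : g ∈ X := hT.1 (by simp)
      have h := three_le_card_filter_good_pairs hcirc hC1 hIind hIE (hXcl e heX) (hXcl f hfX) (hXcl g hgX)
        (hXI e heX) (hXI f hfX) (hXI g hgX) hef heg hfg
      rw [Finset.card_eq_three.2 ⟨e, f, g, hef, heg, hfg, rfl⟩]
      refine h.trans (le_of_eq ?_)
      congr 1
      apply Finset.filter_congr
      intro P _
      rw [hgood]
      simp only [Finset.coe_insert, Finset.coe_singleton]
    calc X.card + 3 * X.card.choose 2 + 3 * X.card.choose 3
        = ∑ _T ∈ X.powersetCard 1, 1 + ∑ _T ∈ X.powersetCard 2, 3 + ∑ _T ∈ X.powersetCard 3, 3 := by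
          rw [Finset.sum_const, Finset.sum_const, Finset.sum_const, Finset.card_powersetCard,
            Finset.card_powersetCard, Finset.card_powersetCard, smul_eq_mul, smul_eq_mul, smul_eq_mul,
            Nat.choose_one_right]
          ring
      _ ≤ _ := add_le_add (add_le_add (Finset.sum_le_sum h1) (Finset.sum_le_sum h2)) (Finset.sum_le_sum h3)
  rw [← hXcard]
  exact hcount.trans hcardS

end S2

end PercRepro
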